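import Literature.NumberTheory.Transcendental.RoySmallValueBasic
import HarnessLib

/-!
# Roy's small value estimate for `𝔾ₐ × 𝔾ₘ` — the ideals `I^{(γ,T)}`: vanishing of `𝒟`-derivatives at `(1, γ)`

Topic `Literature/NumberTheory/Transcendental`. Part of the formalisation of the proof of Roy 2013,
Theorem 1.1 (named fact `roy2013_thm_1_1`, `RoySmallValueEstimates.lean`). Source: D. Roy,
*A small value estimate for `𝔾ₐ × 𝔾ₘ`*, Mathematika 59 (2013) 333–363 = arXiv:1301.0663, §3
(p. 8 of the arXiv text): "for each `T ∈ ℕ*`, we denote by `I^{(γ,T)}` the ideal of `ℂ[X]`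
generated by all homogeneous polynomials `P` satisfying `𝒟ⁱP(1, γ) = 0` for `i = 0, …, T-1`.
For `L ∈ ℕ`, the symbol `I_L^{(γ,T)}` represents its homogeneous part of degree `L`."

We introduce the (in general inhomogeneous) ideal

* `vanIdeal ξ η T = {F ∈ ℂ[X] : 𝒟ⁱF(1, ξ, η) = 0 for all i < T}`

of ALL polynomials whose first `T` derivatives along `𝒟` vanish at `(1, γ)`, `γ = (ξ, η)`. It is
an ideal because `𝒟` is a derivation (`aeval_iterate_homD_mul_eq_zero`, the Leibniz induction), and
Roy's `I^{(γ,T)}` is the ideal generated by its homogeneous elements (its homogeneous core), so that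
**`I_L^{(γ,T)} = vanIdeal ξ η T ∩ ℂ[X]_L`**: a homogeneous `Q` of degree `L` lies in `I^{(γ,T)}`
iff `Q ∈ vanIdeal ξ η T`. All statements of §§3–4 of the paper about elements of `I_L^{(γ,T)}`
are therefore phrased below and in the sequel with the pair of hypotheses
`Q.IsHomogeneous L`, `Q ∈ vanIdeal ξ η T`.

Also here: `X₀^m F ∈ vanIdeal ↔ F ∈ vanIdeal` (`𝒟X₀ = 0`, `X₀(1, γ) = 1`; this replaces the appeal
to the primary decomposition, Corollary 3.4, in the proof of Lemma 3.5), and the elementary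
**monomial partition** opening the proof of Lemma 3.5: if `N ≥ 3a - 2` then every monomial of
degree `N` is divisible by `X₀^a`, `X₁^a` or `X₂^a`, so every `Q ∈ ℂ[X]_N` is
`X₀^a P₀ + X₁^a P₁ + X₂^a P₂` with `Pⱼ ∈ ℂ[X]_{N-a}` and `𝓛(P₀) + 𝓛(P₁) + 𝓛(P₂) ≤ 𝓛(Q)`
(`exists_partition_X_pow`).

Everything here is proved; one definition (`vanIdeal`), no new named facts.

## References

* [Roy2013] D. Roy, *A small value estimate for 𝔾ₐ × 𝔾ₘ*, Mathematika 59 (2013), 333–363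
  (arXiv:1301.0663), §3 (the ideals `I^{(γ,T)}`), proof of Lemma 3.5.
-/

noncomputable section

open MvPolynomial Finset

namespace Literature.NumberTheory.Transcendental

namespace Roy2013

open Nesterenko

/-! ### Iterated derivatives of products: the Leibniz induction -/

/-- `𝒟ⁱ` is additive. [folklore] -/
theorem iterate_homD_add (F G : CX) (i : ℕ) : homD^[i] (F + G) = homD^[i] F + homD^[i] G := by
  induction i generalizing F G with
  | zero => rfl
  | succ i ih => rw [Function.iterate_succ_apply, Function.iterate_succ_apply,
      Function.iterate_succ_apply, map_add, ih]

/-- `𝒟ⁱ` commutes with scalars. [folklore] -/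
theorem iterate_homD_smul (c : ℂ) (F : CX) (i : ℕ) : homD^[i] (c • F) = c • homD^[i] F := by
  induction i generalizing F with
  | zero => rfl
  | succ i ih => rw [Function.iterate_succ_apply, Function.iterate_succ_apply, homD.map_smul, ih]

/-- `𝒟ⁱ(-F) = -𝒟ⁱF`. [folklore] -/
theorem iterate_homD_neg (F : CX) (i : ℕ) : homD^[i] (-F) = -homD^[i] F := by
  rw [← neg_one_smul ℂ F, iterate_homD_smul, neg_one_smul]

/-- `𝒟ⁱ(F - G) = 𝒟ⁱF - 𝒟ⁱG`. [folklore] -/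
theorem iterate_homD_sub (F G : CX) (i : ℕ) : homD^[i] (F - G) = homD^[i] F - homD^[i] G := by
  rw [sub_eq_add_neg, iterate_homD_add, iterate_homD_neg, ← sub_eq_add_neg]

/-- **Leibniz induction**: if `𝒟ᵏG(1, γ) = 0` for all `k ≤ i`, then `𝒟ⁱ(FG)(1, γ) = 0` for every
`F` (from `𝒟(FG) = 𝒟F·G + F·𝒟G`). [cite: Roy2013, §3 (the ideals `I^{(γ,T)}`)] -/
theorem aeval_iterate_homD_mul_eq_zero (ξ η : ℂ) :
    ∀ (i : ℕ) (F G : CX), (∀ k ≤ i, aeval ![1, ξ, η] (homD^[k] G) = 0) →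
      aeval ![1, ξ, η] (homD^[i] (F * G)) = 0 := by
  intro i
  induction i with
  | zero =>
    intro F G hG
    have := hG 0 le_rfl
    rw [Function.iterate_zero_apply] at this ⊢
    rw [map_mul, this, mul_zero]
  | succ i ih =>
    intro F G hG
    have h1 : aeval ![1, ξ, η] (homD^[i] (F * homD G)) = 0 := by
      refine ih F (homD G) fun k hk => ?_
      rw [← Function.iterate_succ_apply]
      exact hG (k + 1) (by omega)
    have h2 : aeval ![1, ξ, η] (homD^[i] (homD F * G)) = 0 :=
      ih (homD F) G fun k hk => hG k (by omega)
    rw [Function.iterate_succ_apply, Derivation.leibniz, smul_eq_mul, smul_eq_mul,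
      iterate_homD_add, map_add, mul_comm G (homD F), h1, h2, add_zero]

/-! ### The ideal `vanIdeal ξ η T` -/

/-- The ideal of all `F ∈ ℂ[X₀, X₁, X₂]` with `𝒟ⁱF(1, ξ, η) = 0` for `0 ≤ i < T`. Roy's
`I^{(γ,T)}` (`γ = (ξ, η)`) is the ideal generated by its homogeneous elements, and the degree-`L`
part `I_L^{(γ,T)}` of the latter is `vanIdeal ξ η T ∩ ℂ[X]_L`.
[cite: Roy2013, §3 (the ideals `I^{(γ,T)}`, p. 8)] -/
def vanIdeal (ξ η : ℂ) (T : ℕ) : Ideal CX where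
  carrier := {F | ∀ i < T, aeval ![1, ξ, η] (homD^[i] F) = 0}
  zero_mem' := fun i _ => by
    rw [Function.iterate_fixed (map_zero homD) i, map_zero]
  add_mem' := fun {F G} hF hG i hi => by
    rw [iterate_homD_add, map_add, hF i hi, hG i hi, add_zero]
  smul_mem' := fun F {G} hG i hi => by
    rw [smul_eq_mul]
    exact aeval_iterate_homD_mul_eq_zero ξ η i F G fun k hk => hG k (by omega)

/-- Membership in `vanIdeal`. [cite: Roy2013, §3 (the ideals `I^{(γ,T)}`, p. 8)] -/
theorem mem_vanIdeal_iff {ξ η : ℂ} {T : ℕ} {F : CX} :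
    F ∈ vanIdeal ξ η T ↔ ∀ i < T, aeval ![1, ξ, η] (homD^[i] F) = 0 := Iff.rfl

/-- `vanIdeal` decreases as `T` grows. [folklore] -/
theorem vanIdeal_mono {ξ η : ℂ} {T T' : ℕ} (h : T ≤ T') : vanIdeal ξ η T' ≤ vanIdeal ξ η T :=
  fun _ hF i hi => hF i (lt_of_lt_of_le hi h)

/-- Every polynomial lies in `vanIdeal ξ η 0`. [folklore] -/
theorem vanIdeal_zero (ξ η : ℂ) : vanIdeal ξ η 0 = ⊤ :=
  eq_top_iff.mpr fun _ _ i hi => absurd hi (Nat.not_lt_zero i)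

/-! ### Multiplication by powers of `X₀` -/

/-- `𝒟(X₀^m F) = X₀^m 𝒟F`. [cite: Roy2013, §3 (proof of Lemma 3.5)] -/
theorem homD_X_zero_pow_mul (m : ℕ) (F : CX) : homD (X 0 ^ m * F) = X 0 ^ m * homD F := by
  rw [Derivation.leibniz, Derivation.leibniz_pow, homD_X_zero]
  simp only [smul_eq_mul, mul_zero, smul_zero, add_zero]

/-- `𝒟ⁱ(X₀^m F) = X₀^m 𝒟ⁱF`. [cite: Roy2013, §3 (proof of Lemma 3.5)] -/
theorem iterate_homD_X_zero_pow_mul (m : ℕ) (F : CX) (i : ℕ) :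
    homD^[i] (X 0 ^ m * F) = X 0 ^ m * homD^[i] F := by
  induction i generalizing F with
  | zero => rfl
  | succ i ih => rw [Function.iterate_succ_apply, Function.iterate_succ_apply,
      homD_X_zero_pow_mul, ih]

/-- `(X₀^m F)(1, γ) = F(1, γ)`. [folklore] -/
theorem aeval_one_X_zero_pow_mul (ξ η : ℂ) (m : ℕ) (F : CX) :
    aeval ![1, ξ, η] (X 0 ^ m * F) = aeval ![1, ξ, η] F := by
  rw [map_mul, map_pow, aeval_X, Matrix.cons_val_zero, one_pow, one_mul]

/-- **`X₀^m F ∈ I^{(γ,T)} ↔ F ∈ I^{(γ,T)}`** (Roy: "`X₀^{N-K}Q₀ ∈ I^{(γ,T)}` and so `Q₀ ∈ I^{(γ,T)}`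
because `X₀ ∉ I_γ`"). [cite: Roy2013, §3, proof of Lemma 3.5] -/
theorem X_zero_pow_mul_mem_vanIdeal_iff {ξ η : ℂ} {T : ℕ} (m : ℕ) (F : CX) :
    X 0 ^ m * F ∈ vanIdeal ξ η T ↔ F ∈ vanIdeal ξ η T := by
  simp only [mem_vanIdeal_iff, iterate_homD_X_zero_pow_mul, aeval_one_X_zero_pow_mul]

/-! ### The monomial partition of the proof of Lemma 3.5 -/

/-- `𝓛(X_j^a F) ≤ 𝓛(F)` (in fact equality). [folklore] -/
theorem l1Norm_X_pow_mul_le (j : Fin 3) (a : ℕ) (F : CX) : l1Norm (X j ^ a * F) ≤ l1Norm F := by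
  refine (l1Norm_mul_le _ _).trans ?_
  refine mul_le_of_le_one_left (l1Norm_nonneg _) ((l1Norm_pow_le _ _).trans ?_)
  rw [l1Norm_X, one_pow]

/-- **Monomial partition** (opening of the proof of Lemma 3.5): if `3a ≤ N + 2` ("`N > 3(N-K-1)`"
with `a = N - K`), every monomial of degree `N` is divisible by `X₀^a`, `X₁^a` or `X₂^a`; hence
every `Q ∈ ℂ[X]_N` splits as `Q = X₀^a P₀ + X₁^a P₁ + X₂^a P₂` with `Pⱼ ∈ ℂ[X]_{N-a}` and
`𝓛(P₀) + 𝓛(P₁) + 𝓛(P₂) ≤ 𝓛(Q)`. [cite: Roy2013, §3, proof of Lemma 3.5] -/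
theorem exists_partition_X_pow {N a : ℕ} (ha : 3 * a ≤ N + 2) (haN : a ≤ N) {Q : CX}
    (hQ : Q.IsHomogeneous N) :
    ∃ P : Fin 3 → CX, (∀ j, (P j).IsHomogeneous (N - a)) ∧
      ∑ j, X j ^ a * P j = Q ∧ ∑ j, l1Norm (P j) ≤ l1Norm Q := by
  classical
  -- which power divides the monomial `X^ν`
  let sel : (Fin 3 →₀ ℕ) → Fin 3 := fun ν => if a ≤ ν 0 then 0 else if a ≤ ν 1 then 1 else 2
  have hsel : ∀ ν ∈ Q.support, a ≤ ν (sel ν) := by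
    intro ν hν
    have hdeg : ν 0 + ν 1 + ν 2 = N := by
      have h : ν.degree = N := by
        rw [Finsupp.degree_eq_weight_one]; exact hQ (mem_support_iff.mp hν)
      rwa [Finsupp.degree_eq_sum, Fin.sum_univ_three] at h
    simp only [sel]
    split_ifs with h0 h1
    · exact h0
    · exact h1
    · show a ≤ ν 2
      omega
  -- the three parts
  let P : Fin 3 → CX := fun j =>
    ∑ ν ∈ Q.support with sel ν = j, monomial (ν - Finsupp.single j a) (Q.coeff ν)
  have hXP : ∀ j, X j ^ a * P j = ∑ ν ∈ Q.support with sel ν = j, monomial ν (Q.coeff ν) := by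
    intro j
    simp only [P, Finset.mul_sum]
    refine Finset.sum_congr rfl fun ν hν => ?_
    rw [mem_filter] at hν
    rw [X_pow_eq_monomial, monomial_mul, one_mul, add_tsub_cancel_of_le]
    exact Finsupp.single_le_iff.mpr (hν.2 ▸ hsel ν hν.1)
  refine ⟨P, fun j => ?_, ?_, ?_⟩
  · -- homogeneity
    refine IsHomogeneous.sum _ _ _ fun ν hν => isHomogeneous_monomial _ ?_
    rw [mem_filter] at hν
    have hle : Finsupp.single j a ≤ ν := Finsupp.single_le_iff.mpr (hν.2 ▸ hsel ν hν.1)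
    have hdeg : ν.degree = N := by
      rw [Finsupp.degree_eq_weight_one]; exact hQ (mem_support_iff.mp hν.1)
    have := congr_arg Finsupp.degree (tsub_add_cancel_of_le hle)
    rw [map_add, Finsupp.degree_single, hdeg] at this
    omega
  · -- the sum
    simp_rw [hXP]
    rw [sum_fiberwise Q.support sel fun ν => monomial ν (Q.coeff ν)]
    exact Q.as_sum.symm
  · -- the lengths
    calc ∑ j, l1Norm (P j)
        ≤ ∑ j, ∑ ν ∈ Q.support with sel ν = j, ‖Q.coeff ν‖ := Finset.sum_le_sum fun j _ => by
          refine (l1Norm_sum_le _ _).trans (Finset.sum_le_sum fun ν _ => ?_)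
          rw [l1Norm_monomial]
      _ = l1Norm Q := sum_fiberwise Q.support sel fun ν => ‖Q.coeff ν‖

end Roy2013

end Literature.NumberTheory.Transcendental
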